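import Literature.MathematicalPhysics.QuantumFieldTheory.Balaban1983to89.B9Thm312WholeHHolderNbr

/-!
# `Balaban1983to89.B9Thm312WholeHZ` — [B9] Theorem 3.12 (p. 423), the H-part (3.126) ∕ (3.133) RE-CLASSED: the factorisation H = (G₀Q\*)∘(QGQ\*)⁻¹ read
# through an ARBITRARY coarse intermediate block norm `bZ` (repair road R1-cls of the located vacuity «C-LETTER-FLAT-AT-ONE» of the N06 certificate)

T. Bałaban, *Propagators for lattice gauge theories in a background field*, Commun. Math. Phys. **99** (1985) 389–434 [`Balaban1985BackgroundPropagators`,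
"B9"]; [4] = T. Bałaban, *Propagators and renormalization transformations for lattice gauge theories. II*, Commun. Math. Phys. **96** (1984) 223–250
[`Balaban1984PropagatorsII`].  statement-level skeleton of published theorems with citation tags; proofs where landed; nothing here is a claim about
the Yang–Mills mass gap.

THE PRINT.  p. 420, (3.126): *"HB = GQ\*(QGQ\*)⁻¹B.  We have obtained formally the same representation for the operator H as in [3, 4] (1.103), (2.35)"*;
p. 422, (3.132): the bound on (QGQ\*)⁻¹(y, y′), *"The above inequality together with Theorem 3.3 for G … give"* (3.133) (the three members |H(x,y′)|,
|∇H(x,y′)|, ‖ζ∇H(·,y′)‖_β against (L^{j′}η)^{−d}e^{−(1∕2)δ₀d(y,y′)}).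

WHY THIS FILE (pub-ymgap bus 2026-08-27: dag-n06-h LOCATED «C-LETTER-FLAT-AT-ONE» + `B9LettersHCOneObstruction.hlettersH_flat_pins_false`, node00-def-Y WORD
(W2), director-ym LINE №198, dag-n06-l R-WORD «R1-cls»).  dag-n06-l's schema `B9Thm312WholeH.LettersH` reads the factorisation H = (G₀Q\*) ∘ C, C =
(QGQ\*)⁻¹, through the FLAT coarse class 𝔠_Z⁽⁰⁾ (`gQs2 : Z⁰ → 𝔠²`, `c2 : Z² → Z⁰`).  At node00-def-Y's pins the coarse letters are matrices in the flat
coordinate basis of the coarse bond functions, in which print's adjoint Q\* is `QsY ∘ N` and (QGQ\*)⁻¹ is `N ∘ C_print` with the block count N = diag(n_y),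
n_y = L^{j(y)(d+1)} (def-Y (W2)); so `c2` at the flat `CcoK` asks `B₃ ≥ (c_R∕A′)·L^{(k−1)(d+1)}` at the top-empty members — no member-uniform B₃ exists
(n06-h's theorem), while H = G₀Q\*C itself is convention-free.  THE REPAIR R1-cls (def-Y's recommended road; nothing of def-Y's or n06-d's modified): read the
SAME factorisation through a coarse intermediate class that is a PARAMETER `bZ : BlockNorm (toB6 g R₀ H₀) (Z → ℝ)` of the schema — the knit pins the
block-count weight `bZ := weightNorm (BlockNorm.ofBlocks … blkZ) (fun y => (n y)⁻¹)`, in which BOTH sides are member-uniform (flat C(b,b) ≍ n_b·len_b⁻²,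
flat (G₀Q\*)(x,b′) ≍ n_{b′}⁻¹·len², def-Y (W2)) and the n's cancel in H as they must.  Block-majorant composition ([4] (2.52)–(2.56)) is class-agnostic,
so the landed cores re-prove verbatim with one generalised token:
* §1 `LettersHZ 𝔬 R₀ H₀ hG bZ B₃ δ₃ U` (= `LettersH` with the middle class `bZ`: `gQs2 : bZ → 𝔠²`, `dgQs : bZ → 𝔠_Y¹`, `c2 ∕ c12 : Z² → bZ`) and
  `LettersHHZ 𝔬 𝔭 R₀ H₀ hlen bZ Bq δ₃ U` (= `B9Thm312WholeHHolder.LettersHH` with `pQ β : bZ → 𝔠_P^{(β−1)}`) — HYPOTHESIS SCHEMAS, nothing asserted;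
* §2 the cores at cutting cost `bZ.κ = 1`: `hasMaj_toR_in`, ★ `H_entry0Z` (H = A∘(Q\*C) : Z² → 𝔠², B₃²c(1−θc)⁻¹e^{−ρd}), ★ `H_entry1Z` (∇H : Z² → Y¹), ★ `hkh_cNormRZ`,
  ★ `hkh_of_step_nbrZ` (the Hölder member of (3.133), neighbourhood co-reading `CoReadsHHolderNbr`) — statements of `B9Thm312WholeH.H_entry0 ∕ H_entry1`,
  `B9Thm312WholeHHolder.hkh_cNormR`, `B9Thm312WholeHHolderNbr.hkh_of_step_nbr` with `cNorm(R) … blkZ … 0 ↦ bZ`; the readers `hk_e0_of_hasMaj ∕ hk_e1_of_hasMaj ∕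
  hkh_le_of_hasMajorantHom_nbr` are consumed BY NAME (their Z-source class 𝔠_Z⁽²⁾ is unchanged).
Sequels (same seat): `B9Thm313WholeZ` (`Letters313Z`), and the two consumed leaves re-issued over the Z-schemas.
HONEST SCOPE.  Count-neutral schema re-classing + kernel-checked bookkeeping; (3.126), (3.130), (3.132), (3.133) are NOT proved here (the letters are
hypotheses of printed shape, now in satisfiable classes); N06 NOT discharged; one finite lattice at a time — nothing continuum ∕ ℝ⁴ ∕ OS ∕ mass gap ∕ Clay.
Cell `pub-ymgap` (HUMAN RULING D-0062), Track A node N06 [B9], bundle F7 rows 20–21, seat `pub-ymgap-dag-n06-l` (g14), 2026-08-27.  NEW file; the flat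
schemas `LettersH ∕ LettersHH` stay in the tree as records; nothing landed is modified.
-/

namespace Literature.MathematicalPhysics.QuantumFieldTheory.Balaban1983to89.B9Thm312WholeHZ

open Literature.MathematicalPhysics.QuantumFieldTheory.Balaban1983to89
open Finset B6RandomWalk B6RandomWalkHom B9Thm34Ext B9Thm37GlueCor36 B11SectG B9SectDSup
open B9Thm37AllNorms B9Thm37AllNormsInstances B9Thm312Whole B9Thm312WholeLeaf B9Thm312WholeLeft B9Thm312WholeH B9RWSums343Holder
open B9Ineq347 B9Thm312WholeClasses B9Thm312WholeHolder B9CoRealizesHRel B9Thm312WholeHHolder B9RWSumsReadsNbr B9Thm312WholeHHolderNbr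

noncomputable section

/-! ## §1 The re-classed letters (printed shape; nothing asserted) -/

section Schemas

variable {g : B9.Geometry} {B : B9.Backgrounds} {X Y Z W PX PY : Type}
variable [Fintype X] [Fintype Y] [Fintype Z] [Fintype PY] [Fintype g.Site]

/-- **THE LETTERS OF H THROUGH A COARSE INTERMEDIATE CLASS `bZ`** (R1-cls form of `B9Thm312WholeH.LettersH`): `gQs2` = the H₀-type entry G₀Q\* of Theorem 3.3's
G₀ from `bZ` into 𝔠⁽²⁾ (|(G₀Q\*b)(x)| ≦ B₃(Lʲη)²e^{−δ₃d}·(size of b in `bZ`)); `dgQs` = ∇_UG₀Q\* from `bZ` into 𝔠_Y⁽¹⁾; `c2`, `c12` = (3.132) for (QGQ\*)⁻¹ and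
(QG₁Q\*)⁻¹ from 𝔠_Z⁽²⁾ into `bZ`.  With `bZ` = the flat 𝔠_Z⁽⁰⁾ this is `LettersH` (unsatisfiable at def-Y's flat `CcoK`, n06-h); the knit pins the block-count
weight n⁻¹, print's normalisation of Q\* and (QGQ\*)⁻¹ (def-Y (W2)).  A HYPOTHESIS SCHEMA; nothing asserted.
[cite: Balaban1985BackgroundPropagators, (3.132) p.422 + (3.126) p.420 + (3.129) p.421 + Thm 3.3 p.399 + p.398 (remark after (3.47))] -/
structure LettersHZ (𝔬 : Ops g B X Y Z W) (R₀ : ℝ) (H₀ : Prop) (hG : GeoOK g) (bZ : BlockNorm (toB6 g R₀ H₀) (Z → ℝ)) (B₃ δ₃ : ℝ)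
    (U : B.Cfg) : Prop where
  gQs2 : HasMaj bZ (cNorm R₀ H₀ 𝔬.blk hG.lenle 2) (𝔬.G0 U ∘ₗ 𝔬.Qstar U) (fun a b => B₃ * Real.exp (-(δ₃ * g.dist a b)))
  dgQs : HasMaj bZ (cNorm R₀ H₀ 𝔬.blkY hG.lenle 1) (𝔬.D U ∘ₗ 𝔬.G0 U ∘ₗ 𝔬.Qstar U) (fun a b => B₃ * Real.exp (-(δ₃ * g.dist a b)))
  c2 : HasMaj (cNorm R₀ H₀ 𝔬.blkZ hG.lenle 2) bZ (𝔬.C U) (fun a b => B₃ * Real.exp (-(δ₃ * g.dist a b)))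
  c12 : HasMaj (cNorm R₀ H₀ 𝔬.blkZ hG.lenle 2) bZ (𝔬.C1 U) (fun a b => B₃ * Real.exp (-(δ₃ * g.dist a b)))

/-- **THE HÖLDER PROBE OF ∇_UG₀Q\* FROM THE COARSE INTERMEDIATE CLASS `bZ`** (R1-cls form of `B9Thm312WholeHHolder.LettersHH`): ‖ζ∇_UG₀Q\*b‖_β as the probe
majorant Φ^Y_β∘∇_U∘G₀∘Q\* from `bZ` into 𝔠_P^{(β−1)}, constant B_q(β).  A HYPOTHESIS SCHEMA; nothing asserted.
[cite: Balaban1985BackgroundPropagators, (3.133) p.422 + (3.126) p.420 + (3.43) p.398 + Thm 3.3 p.399] -/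
structure LettersHHZ (𝔬 : Ops g B X Y Z W) (𝔭 : HolderProbes g B X Y PX PY) (R₀ : ℝ) (H₀ : Prop)
    (hlen : ∀ y : g.Site, 0 ≤ g.len y) (bZ : BlockNorm (toB6 g R₀ H₀) (Z → ℝ)) (Bq : ℝ → ℝ) (δ₃ : ℝ) (U : B.Cfg) : Prop where
  pQ : ∀ β : ℝ, 0 ≤ β → β < 1 → HasMaj bZ (cNormR R₀ H₀ 𝔭.blkPY hlen (β - 1))
    ((𝔭.ΦY U β ∘ₗ 𝔬.D U ∘ₗ 𝔬.G0 U) ∘ₗ 𝔬.Qstar U) (fun a b => Bq β * Real.exp (-(δ₃ * g.dist a b)))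

end Schemas

/-! ## §2 The cores, re-proved through the intermediate class `bZ` (cutting cost 1) -/

section OneMember

variable {g : B9.Geometry} {B : B9.Backgrounds} {X Y Z PX PY : Type}
variable [Fintype X] [Fintype Y] [Fintype Z] [Fintype PX] [Fintype PY] [Fintype g.Site]
variable {R₀ : ℝ} {H₀ : Prop}

omit [Fintype Y] [Fintype PX] [Fintype PY] in
/-- A majorant out of the integer-weight class `cNorm … q` into any block-normed space is the same majorant out of 𝔠^{(−q)} (source side of
`B9Thm312WholeClasses.hasMaj_toR`). [cite: Balaban1985BackgroundPropagators, (3.42) p.397 (bookkeeping)] -/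
theorem hasMaj_toR_in (hG : GeoOK g) {F : Type} [AddCommGroup F] [Module ℝ F] {b : BlockNorm (toB6 g R₀ H₀) F} {blkZ : Z → g.Site}
    {T : (Z → ℝ) →ₗ[ℝ] F} {K : g.Site → g.Site → ℝ} {q : ℕ} (h : HasMaj (cNorm R₀ H₀ blkZ hG.lenle q) b T K) :
    HasMaj (cNormR R₀ H₀ blkZ hG.lenle (-(q : ℝ))) b T K := by
  intro y' μ hμ y
  rw [cNormR_loc_neg_natCast hG]
  exact h y' μ hμ y

omit [Fintype Y] [Fintype PX] [Fintype PY] in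
/-- ★ **H = A∘(Q\*C) AS A RIGHT ENTRY OF A = G (OR G₁), THROUGH `bZ`** (statement of `B9Thm312WholeH.H_entry0` with the middle class generalised): G₀Q\* : bZ → 𝔠⁽²⁾
(B₃e^{−δ₃d}) after C : Z² → bZ (B₃e^{−δ₃d}), `bZ.κ = 1`, gives G₀Q\*C : Z² → 𝔠⁽²⁾ (B₃²c·e^{−ρd}), and the Neumann bound of `…Leaf.hasMaj_right_of_step` gives
A∘(Q\*C) the majorant B₃²c(1 − θc)⁻¹e^{−ρd}. [cite: Balaban1985BackgroundPropagators, (3.126) p.420 + (3.129) p.421 + (3.132) p.422 + (3.130) p.421; Balaban1984PropagatorsII, Lemma 2.1 p.234] -/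
theorem H_entry0Z (hG : GeoOK g) {blk : X → g.Site} {blkZ : Z → g.Site} {bZ : BlockNorm (toB6 g R₀ H₀) (Z → ℝ)}
    {G0 T A : Module.End ℝ (X → ℝ)} {Qs : (Z → ℝ) →ₗ[ℝ] (X → ℝ)} {Cop : Module.End ℝ (Z → ℝ)} {θ B₃ δ₃ δK ρ σ c : ℝ}
    (hrow : RowSum (toB6 g R₀ H₀) σ c) (hκ : bZ.κ = 1)
    (hc : 0 ≤ c) (hθ : 0 ≤ θ) (hB₃ : 0 ≤ B₃) (hσ : 0 ≤ σ) (hρ : 0 ≤ ρ) (hρ₃ : ρ + σ ≤ δ₃) (hρδ : ρ + σ ≤ δK)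
    (hK : HasMaj (cNorm R₀ H₀ blk hG.lenle 2) (cNorm R₀ H₀ blk hG.lenle 2) (G0 ∘ₗ T) (fun a b => θ * Real.exp (-(δK * g.dist a b))))
    (hQs : HasMaj bZ (cNorm R₀ H₀ blk hG.lenle 2) (G0 ∘ₗ Qs) (fun a b => B₃ * Real.exp (-(δ₃ * g.dist a b))))
    (hCop : HasMaj (cNorm R₀ H₀ blkZ hG.lenle 2) bZ Cop (fun a b => B₃ * Real.exp (-(δ₃ * g.dist a b))))
    (hfix : A = G0 + G0 ∘ₗ T ∘ₗ A) (hq : θ * c < 1) :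
    HasMaj (cNorm R₀ H₀ blkZ hG.lenle 2) (cNorm R₀ H₀ blk hG.lenle 2) (A ∘ₗ (Qs ∘ₗ Cop))
      (fun a b => B₃ * B₃ * c * (1 - θ * c)⁻¹ * Real.exp (-(ρ * g.dist a b))) := by
  have htri : Triangle254 (toB6 g R₀ H₀) := fun a b c => hG.tri a b c
  have hS : HasMaj (cNorm R₀ H₀ blkZ hG.lenle 2) (cNorm R₀ H₀ blk hG.lenle 2) (G0 ∘ₗ (Qs ∘ₗ Cop))
      (fun a b => bZ.κ * B₃ * B₃ * c * Real.exp (-(ρ * g.dist a b))) :=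
    hasMaj_comp_exp htri hG.dnn hrow hB₃ hB₃ hρ (by linarith) hρ₃ hQs hCop
  rw [hκ] at hS
  simp only [one_mul] at hS
  exact hasMaj_right_of_step hG hrow hθ (mul_nonneg (mul_nonneg hB₃ hB₃) hc) hρ le_rfl hρδ hK hS hfix hq

omit [Fintype PX] [Fintype PY] in
/-- ★ **∇_UH = ∇_UA∘(Q\*C) AS A LEFT-AND-RIGHT ENTRY, THROUGH `bZ`** (statement of `B9Thm312WholeH.H_entry1` with the middle class generalised).
[cite: Balaban1985BackgroundPropagators, (3.133) p.422 + (3.126) p.420 + (3.130) p.421; Balaban1984PropagatorsII, Lemma 2.1 p.234] -/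
theorem H_entry1Z (hG : GeoOK g) {blk : X → g.Site} {blkY : Y → g.Site} {blkZ : Z → g.Site} {bZ : BlockNorm (toB6 g R₀ H₀) (Z → ℝ)}
    {G0 T A : Module.End ℝ (X → ℝ)} {Dop : (X → ℝ) →ₗ[ℝ] (Y → ℝ)} {Qs : (Z → ℝ) →ₗ[ℝ] (X → ℝ)} {Cop : Module.End ℝ (Z → ℝ)}
    {θ θ' B₃ δ₃ δK ρ σ c : ℝ} (hrow : RowSum (toB6 g R₀ H₀) σ c) (hκ : bZ.κ = 1)
    (hc : 0 ≤ c) (hθ : 0 ≤ θ) (hθ' : 0 ≤ θ') (hB₃ : 0 ≤ B₃) (hσ : 0 ≤ σ) (hρ : 0 ≤ ρ) (hρ₃ : ρ + σ ≤ δ₃) (hρδ : ρ + σ ≤ δK)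
    (hK : HasMaj (cNorm R₀ H₀ blk hG.lenle 2) (cNorm R₀ H₀ blk hG.lenle 2) (G0 ∘ₗ T) (fun a b => θ * Real.exp (-(δK * g.dist a b))))
    (hKD : HasMaj (cNorm R₀ H₀ blk hG.lenle 2) (cNorm R₀ H₀ blkY hG.lenle 1) (Dop ∘ₗ G0 ∘ₗ T)
      (fun a b => θ' * Real.exp (-(δK * g.dist a b))))
    (hQs : HasMaj bZ (cNorm R₀ H₀ blk hG.lenle 2) (G0 ∘ₗ Qs) (fun a b => B₃ * Real.exp (-(δ₃ * g.dist a b))))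
    (hDQs : HasMaj bZ (cNorm R₀ H₀ blkY hG.lenle 1) (Dop ∘ₗ G0 ∘ₗ Qs) (fun a b => B₃ * Real.exp (-(δ₃ * g.dist a b))))
    (hCop : HasMaj (cNorm R₀ H₀ blkZ hG.lenle 2) bZ Cop (fun a b => B₃ * Real.exp (-(δ₃ * g.dist a b))))
    (hfix : A = G0 + G0 ∘ₗ T ∘ₗ A) (hq : θ * c < 1) :
    HasMaj (cNorm R₀ H₀ blkZ hG.lenle 2) (cNorm R₀ H₀ blkY hG.lenle 1) (Dop ∘ₗ A ∘ₗ (Qs ∘ₗ Cop))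
      (fun a b => (B₃ * B₃ * c + θ' * (B₃ * B₃ * c * (1 - θ * c)⁻¹) * c) * Real.exp (-(ρ * g.dist a b))) := by
  have htri : Triangle254 (toB6 g R₀ H₀) := fun a b c => hG.tri a b c
  have hq1 : 0 ≤ (1 - θ * c)⁻¹ := inv_nonneg.mpr (by linarith)
  have hB : 0 ≤ B₃ * B₃ * c := mul_nonneg (mul_nonneg hB₃ hB₃) hc
  have hH := H_entry0Z hG hrow hκ hc hθ hB₃ hσ hρ hρ₃ hρδ hK hQs hCop hfix hq
  have hEF : HasMaj (cNorm R₀ H₀ blkZ hG.lenle 2) (cNorm R₀ H₀ blkY hG.lenle 1) ((Dop ∘ₗ G0 ∘ₗ Qs) ∘ₗ Cop)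
      (fun a b => bZ.κ * B₃ * B₃ * c * Real.exp (-(ρ * g.dist a b))) :=
    hasMaj_comp_exp htri hG.dnn hrow hB₃ hB₃ hρ (by linarith) hρ₃ hDQs hCop
  rw [hκ] at hEF
  simp only [one_mul] at hEF
  have hEF' : HasMaj (cNorm R₀ H₀ blkZ hG.lenle 2) (cNorm R₀ H₀ blkY hG.lenle 1) (Dop ∘ₗ G0 ∘ₗ (Qs ∘ₗ Cop))
      (fun a b => B₃ * B₃ * c * Real.exp (-(ρ * g.dist a b))) := hEF.congr fun b => rfl
  -- ∇A𝒳 = ∇G₀𝒳 + (∇G₀T)(A𝒳), one composition through 𝔠⁽²⁾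
  have h2 : HasMaj (cNorm R₀ H₀ blkZ hG.lenle 2) (cNorm R₀ H₀ blkY hG.lenle 1) ((Dop ∘ₗ G0 ∘ₗ T) ∘ₗ (A ∘ₗ (Qs ∘ₗ Cop)))
      (fun y y' => (cNorm R₀ H₀ blk hG.lenle 2 (X := X)).κ * θ' * (B₃ * B₃ * c * (1 - θ * c)⁻¹) * c *
        Real.exp (-(ρ * g.dist y y'))) :=
    hasMaj_comp_exp htri hG.dnn hrow hθ' (mul_nonneg hB hq1) hρ le_rfl hρδ hKD hH
  simp only [cNorm_κ, one_mul] at h2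
  have hsum := hEF'.add h2
  have e : Dop ∘ₗ A ∘ₗ (Qs ∘ₗ Cop) = Dop ∘ₗ G0 ∘ₗ (Qs ∘ₗ Cop) + (Dop ∘ₗ G0 ∘ₗ T) ∘ₗ (A ∘ₗ (Qs ∘ₗ Cop)) := by
    refine LinearMap.ext fun v => ?_
    have hpt : A (Qs (Cop v)) = G0 (Qs (Cop v)) + G0 (T (A (Qs (Cop v)))) := by
      conv_lhs => rw [hfix]
      simp only [LinearMap.add_apply, LinearMap.comp_apply]
    simp only [LinearMap.comp_apply, LinearMap.add_apply]
    conv_lhs => rw [hpt]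
    rw [map_add]
  rw [← e] at hsum
  exact hsum.mono fun y y' => le_of_eq (by ring)

omit [Fintype Y] [Fintype PX] in
/-- ★ **Φ^Y_β∘∇_U∘H IN THE WEIGHTED CLASSES, THROUGH `bZ`** (statement of `B9Thm312WholeHHolder.hkh_cNormR` with the middle class generalised): the letter
`hpQ` (B_q e^{−δ₃d}, `bZ` → 𝔠_P^{(β−1)}) after the (3.132) letter C (B₃e^{−δ₃d}, 𝔠_Z^{(−2)} → `bZ`), and the probe step `hpY` after the proved entry H:
majorant (B_qB₃c + θ_HK_Hc)·e^{−ρd} from 𝔠_Z^{(−2)} into 𝔠_P^{(β−1)}.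
[cite: Balaban1985BackgroundPropagators, (3.133) p.422 + (3.126) p.420 + (3.130) p.421 + (3.132) p.422; Balaban1984PropagatorsII, Lemma 2.1 p.234] -/
theorem hkh_cNormRZ (hG : GeoOK g) {blk : X → g.Site} {blkZ : Z → g.Site} {blkP : PY → g.Site} {bZ : BlockNorm (toB6 g R₀ H₀) (Z → ℝ)}
    {G0 T A : Module.End ℝ (X → ℝ)} {E : (X → ℝ) →ₗ[ℝ] (PY → ℝ)} {Qs : (Z → ℝ) →ₗ[ℝ] (X → ℝ)} {Cop : Module.End ℝ (Z → ℝ)}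
    {Hop : (Z → ℝ) →ₗ[ℝ] (X → ℝ)} {θH Bq B₃ KH β δ₃ δK ρ σ c : ℝ} (hrow : RowSum (toB6 g R₀ H₀) σ c) (hκ : bZ.κ = 1)
    (hθH : 0 ≤ θH) (hBq : 0 ≤ Bq) (hB₃ : 0 ≤ B₃) (hKH : 0 ≤ KH) (hσ : 0 ≤ σ) (hρ : 0 ≤ ρ) (hρ₃ : ρ + σ ≤ δ₃)
    (hρδ : ρ + σ ≤ δK)
    (hpQ : HasMaj bZ (cNormR R₀ H₀ blkP hG.lenle (β - 1)) ((E ∘ₗ G0) ∘ₗ Qs) (fun a b => Bq * Real.exp (-(δ₃ * g.dist a b))))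
    (hCop : HasMaj (cNorm R₀ H₀ blkZ hG.lenle 2) bZ Cop (fun a b => B₃ * Real.exp (-(δ₃ * g.dist a b))))
    (hpY : HasMaj (cNormR R₀ H₀ blk hG.lenle (-2)) (cNormR R₀ H₀ blkP hG.lenle (β - 1)) ((E ∘ₗ G0) ∘ₗ T)
      (fun a b => θH * Real.exp (-(δK * g.dist a b))))
    (hH : HasMaj (cNorm R₀ H₀ blkZ hG.lenle 2) (cNorm R₀ H₀ blk hG.lenle 2) Hop (fun a b => KH * Real.exp (-(ρ * g.dist a b))))
    (hHop : Hop = A ∘ₗ (Qs ∘ₗ Cop)) (hfix : A = G0 + G0 ∘ₗ T ∘ₗ A) :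
    HasMaj (cNormR R₀ H₀ blkZ hG.lenle (-2)) (cNormR R₀ H₀ blkP hG.lenle (β - 1)) (E ∘ₗ Hop)
      (fun a b => (Bq * B₃ * c + θH * KH * c) * Real.exp (-(ρ * g.dist a b))) := by
  have htri : Triangle254 (toB6 g R₀ H₀) := fun a b c => hG.tri a b c
  -- the letter C and the entry H in the real-weight classes
  have hC' : HasMaj (cNormR R₀ H₀ blkZ hG.lenle (-2)) bZ Cop (fun a b => B₃ * Real.exp (-(δ₃ * g.dist a b))) := by
    have h := hasMaj_toR_in hG hCop
    simp only [Nat.cast_ofNat] at h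
    exact h
  have hH' : HasMaj (cNormR R₀ H₀ blkZ hG.lenle (-2)) (cNormR R₀ H₀ blk hG.lenle (-2)) Hop
      (fun a b => KH * Real.exp (-(ρ * g.dist a b))) := by
    have h := hasMaj_toR hG hH
    simp only [Nat.cast_ofNat] at h
    exact h
  -- (Φ∇G₀Q*)∘C : 𝔠_Z^{(−2)} → 𝔠_P^{(β−1)} through bZ
  have h1 : HasMaj (cNormR R₀ H₀ blkZ hG.lenle (-2)) (cNormR R₀ H₀ blkP hG.lenle (β - 1)) (((E ∘ₗ G0) ∘ₗ Qs) ∘ₗ Cop)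
      (fun a b => bZ.κ * Bq * B₃ * c * Real.exp (-(ρ * g.dist a b))) :=
    hasMaj_comp_exp htri hG.dnn hrow hBq hB₃ hρ (by linarith) hρ₃ hpQ hC'
  rw [hκ] at h1
  simp only [one_mul] at h1
  -- (Φ∇G₀T)∘H : 𝔠_Z^{(−2)} → 𝔠_P^{(β−1)}
  have h2 : HasMaj (cNormR R₀ H₀ blkZ hG.lenle (-2)) (cNormR R₀ H₀ blkP hG.lenle (β - 1)) (((E ∘ₗ G0) ∘ₗ T) ∘ₗ Hop)
      (fun a b => (cNormR R₀ H₀ blk hG.lenle (-2) (X := X)).κ * θH * KH * c * Real.exp (-(ρ * g.dist a b))) :=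
    hasMaj_comp_exp htri hG.dnn hrow hθH hKH hρ le_rfl hρδ hpY hH'
  simp only [cNormR_κ, one_mul] at h2
  have hsum := h1.add h2
  have hop : E ∘ₗ Hop = ((E ∘ₗ G0) ∘ₗ Qs) ∘ₗ Cop + ((E ∘ₗ G0) ∘ₗ T) ∘ₗ Hop := by
    rw [hHop]
    conv_lhs => rw [comp_fix_rightEntry (Qs ∘ₗ Cop) hfix]
    rw [LinearMap.comp_add]
    exact LinearMap.ext fun _ => rfl
  rw [← hop] at hsum
  exact hsum.mono fun a b => le_of_eq (by ring)

omit [Fintype Y] [Fintype PX] in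
/-- ★ **THE HÖLDER MEMBER OF (3.133) FOR H (OR H₁), NEIGHBOURHOOD READING, THROUGH `bZ`** (statement of `B9Thm312WholeHHolderNbr.hkh_of_step_nbr` with the
middle class generalised): `Hk.h U β ζ y′ ≦ (CL²·e^{r(1−α)ρ}·C·Λ)·(‖ζ‖^ξ_β + |ζ|)·(Lʲη)^{−(1+β)}·(L^{j′}η)^{−d}·e^{−(1−α)ρd(y,y′)}`, C = B_qB₃c + θ_HK_Hc.
[cite: Balaban1985BackgroundPropagators, (3.133) p.422 + (3.126) p.420 + (3.130) p.421 + p.398 (remark after (3.47)) + p.397 (Δ̃); Balaban1984PropagatorsII, (2.51) p.232 + (2.60) p.234] -/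
theorem hkh_of_step_nbrZ (hG : GeoOK g) {Hk : B9.HKernel g B} {U : B.Cfg} {d : ℕ}
    (𝔭 : HolderProbes g B X Y PX PY) {r CL : ℝ} {blk : X → g.Site} {blkZ : Z → g.Site} {bZ : BlockNorm (toB6 g R₀ H₀) (Z → ℝ)}
    {G0 T A : Module.End ℝ (X → ℝ)} {Dop : (X → ℝ) →ₗ[ℝ] (Y → ℝ)} {Qs : (Z → ℝ) →ₗ[ℝ] (X → ℝ)} {Cop : Module.End ℝ (Z → ℝ)}
    {Hop : (Z → ℝ) →ₗ[ℝ] (X → ℝ)} {θH Bq B₃ KH β δ₃ δK ρ α Λ σ c : ℝ} (hrow : RowSum (toB6 g R₀ H₀) σ c) (hκ : bZ.κ = 1)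
    (hθH : 0 ≤ θH) (hBq : 0 ≤ Bq) (hB₃ : 0 ≤ B₃) (hKH : 0 ≤ KH) (hΛ : 0 ≤ Λ) (hσ : 0 ≤ σ) (hρ : 0 ≤ ρ) (hρ₃ : ρ + σ ≤ δ₃)
    (hρδ : ρ + σ ≤ δK) (hα1 : α ≤ 1) (hβ0 : 0 ≤ β) (hβ1 : β ≤ 1)
    (hC : CoReadsHHolderNbr Hk U d 𝔭 r blkZ (Dop ∘ₗ Hop))
    (hCL1 : 1 ≤ CL) (hCL : ∀ a a' : g.Site, g.dist a a' ≤ r → g.len a ≤ CL * g.len a')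
    (hST : ScaleTransfer g ρ α Λ (fun y => g.len y ^ (2 : ℝ)))
    (hpQ : HasMaj bZ (cNormR R₀ H₀ 𝔭.blkPY hG.lenle (β - 1)) ((𝔭.ΦY U β ∘ₗ Dop ∘ₗ G0) ∘ₗ Qs)
      (fun a b => Bq * Real.exp (-(δ₃ * g.dist a b))))
    (hCop : HasMaj (cNorm R₀ H₀ blkZ hG.lenle 2) bZ Cop (fun a b => B₃ * Real.exp (-(δ₃ * g.dist a b))))
    (hpY : HasMaj (cNormR R₀ H₀ blk hG.lenle (-2)) (cNormR R₀ H₀ 𝔭.blkPY hG.lenle (β - 1)) ((𝔭.ΦY U β ∘ₗ Dop ∘ₗ G0) ∘ₗ T)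
      (fun a b => θH * Real.exp (-(δK * g.dist a b))))
    (hH : HasMaj (cNorm R₀ H₀ blkZ hG.lenle 2) (cNorm R₀ H₀ blk hG.lenle 2) Hop (fun a b => KH * Real.exp (-(ρ * g.dist a b))))
    (hHop : Hop = A ∘ₗ (Qs ∘ₗ Cop)) (hfix : A = G0 + G0 ∘ₗ T ∘ₗ A) :
    ∀ (ζ : g.Cut) (y y' : g.Site), g.cutInT ζ y →
      Hk.h U β ζ y' ≤ (CL ^ 2 * Real.exp (r * ((1 - α) * ρ)) * ((Bq * B₃ * c + θH * KH * c) * Λ)) * g.cutH β ζ *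
        (g.len y) ^ (-(1 + β)) * (g.len y') ^ (-(d : ℝ)) * Real.exp (-((1 - α) * ρ * g.dist y y')) := by
  -- the proof of `B9Thm312WholeHHolderNbr.hkh_of_step_nbr`, with `hkh_cNormRZ` in place of `hkh_cNormR`
  intro ζ y y' hζ
  have hc : 0 ≤ c ∨ IsEmpty g.Site := by
    by_cases hne : Nonempty g.Site
    · exact Or.inl (hrow.nonneg hne.some)
    · exact Or.inr (not_nonempty_iff.mp hne)
  rcases hc with hc | hemp
  swap
  · exact (hemp.false y).elim
  set K : ℝ := Bq * B₃ * c + θH * KH * c with hK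
  have hK0 : 0 ≤ K := add_nonneg (mul_nonneg (mul_nonneg hBq hB₃) hc) (mul_nonneg (mul_nonneg hθH hKH) hc)
  have hW := hkh_cNormRZ (E := 𝔭.ΦY U β ∘ₗ Dop) hG hrow hκ hθH hBq hB₃ hKH hσ hρ hρ₃ hρδ hpQ hCop hpY hH hHop hfix
  have h' := hasMajorantHom_of_hasMaj_cNormR hG (fun a b => mul_nonneg hK0 (Real.exp_nonneg _)) hW
  have hbound : ∀ a b : g.Site, K * Real.exp (-(ρ * g.dist a b)) * g.len a ^ (-(β - 1)) * g.len b ^ (-2 : ℝ) ≤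
      K * Λ * g.len a ^ (-(1 + β)) * Real.exp (-((1 - α) * ρ * g.dist a b)) := by
    intro a b
    have ha : 0 < g.len a := hG.lenpos a
    have hb : 0 < g.len b := hG.lenpos b
    have ht := hST b a
    rw [hG.symm b a] at ht
    have hsplitA : g.len a ^ (-(β - 1)) = g.len a ^ (-(1 + β)) * g.len a ^ (2 : ℝ) := by
      rw [← Real.rpow_add ha]; congr 1; ring
    have hsplit : Real.exp (-(ρ * g.dist a b)) = Real.exp (-((1 - α) * ρ * g.dist a b)) * Real.exp (-(α * ρ * g.dist a b)) := by
      rw [← Real.exp_add]; congr 1; ring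
    have hratio : Real.exp (-(α * ρ * g.dist a b)) * g.len a ^ (2 : ℝ) * g.len b ^ (-2 : ℝ) ≤ Λ := by
      rw [Real.rpow_neg hb.le, ← div_eq_mul_inv, div_le_iff₀ (Real.rpow_pos_of_pos hb _)]
      exact ht
    have hnn : 0 ≤ K * Real.exp (-((1 - α) * ρ * g.dist a b)) * g.len a ^ (-(1 + β)) :=
      mul_nonneg (mul_nonneg hK0 (Real.exp_nonneg _)) (Real.rpow_nonneg ha.le _)
    calc K * Real.exp (-(ρ * g.dist a b)) * g.len a ^ (-(β - 1)) * g.len b ^ (-2 : ℝ)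
        = K * Real.exp (-((1 - α) * ρ * g.dist a b)) * g.len a ^ (-(1 + β)) *
            (Real.exp (-(α * ρ * g.dist a b)) * g.len a ^ (2 : ℝ) * g.len b ^ (-2 : ℝ)) := by rw [hsplitA, hsplit]; ring
      _ ≤ K * Real.exp (-((1 - α) * ρ * g.dist a b)) * g.len a ^ (-(1 + β)) * Λ := mul_le_mul_of_nonneg_left hratio hnn
      _ = K * Λ * g.len a ^ (-(1 + β)) * Real.exp (-((1 - α) * ρ * g.dist a b)) := by ring
  have hA := hasMajorantHom_mono (g := toB6 g R₀ H₀) blkZ 𝔭.blkPY h' hbound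
  have hA' : HasMajorantHom (g := toB6 g R₀ H₀) blkZ 𝔭.blkPY (𝔭.ΦY U β ∘ₗ (Dop ∘ₗ Hop))
      (fun a b => K * Λ * g.len a ^ (-(1 + β)) * Real.exp (-((1 - α) * ρ * g.dist a b))) := hA
  have hδ : 0 ≤ (1 - α) * ρ := mul_nonneg (by linarith) hρ
  have h := hkh_le_of_hasMajorantHom_nbr (R₀ := R₀) (H₀ := H₀) hC hG.lenpos hCL1 hCL hG.tri hG.symm hβ0 hβ1 (mul_nonneg hK0 hΛ) hδ
    hA' y' hζ
  calc Hk.h U β ζ y' ≤ (CL ^ 2 * Real.exp (r * ((1 - α) * ρ)) * (K * Λ)) * g.len y ^ (-(1 + β)) *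
        Real.exp (-((1 - α) * ρ * g.dist y y')) * (g.len y') ^ (-(d : ℝ)) * g.cutH β ζ := h
    _ = (CL ^ 2 * Real.exp (r * ((1 - α) * ρ)) * (K * Λ)) * g.cutH β ζ * (g.len y) ^ (-(1 + β)) * (g.len y') ^ (-(d : ℝ)) *
        Real.exp (-((1 - α) * ρ * g.dist y y')) := by ring

end OneMember

end

end Literature.MathematicalPhysics.QuantumFieldTheory.Balaban1983to89.B9Thm312WholeHZ
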